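import Literature.NumberTheory.PAdicHodge.UnramifiedWittWeights
import Literature.NumberTheory.PAdicHodge.UnramifiedWittBdR
import Literature.NumberTheory.PAdicHodge.BdRCyclotomic
import Literature.NumberTheory.GaloisRepresentations.PadicAlgebraIntegral
import Literature.NumberTheory.GaloisRepresentations.CrystallineDeformationRing
import Literature.NumberTheory.GaloisRepresentations.UnramifiedAdmissible
import HarnessLib

/-!
# Unramified representations are de Rham with Hodge–Tate weights `0` — for Fontaine's `B_dR(F)`

Let `F` be a non-archimedean local field of characteristic `0` with `v(p) < 1`, and
`bdRPeriodRingData hp` Fontaine's field of `p`-adic periods `B_dR(F) = Frac B_dR⁺(F)` as a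
period-ring datum (file `BdRPeriodRingData`: `B_dR^{Γ_F} = F`, `Fil^i = ξ^i B_dR⁺`).  Combining

* the period matrix over `W(k̄)` and `B`-admissibility / weights for every period ring receiving
  `W(k̄)` (files `UnramifiedWittPeriodMatrix`, `UnramifiedWittWeights`), and
* the equivariant, `ℚ_p`- and `θ`-compatible map `W(k̄) → 𝔸_inf → B_dR⁺ → B_dR` with
  `ι(W(k̄)) ⊆ Fil⁰` and "`Fil¹` detects `θ`" (file `UnramifiedWittBdR`),

we obtain Fontaine's theorem **unramified ⇒ crystalline ⇒ de Rham of Hodge–Tate weight `0`**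
(Fontaine 1994, Exp. III §5; Fontaine–Ouyang Prop. 2.14, Thm. 2.13) for the GENUINE `B_dR(F)`:

* `isAdmissible_bdR_of_unramified` — `dim_F D_dR(V) = dim_{ℚ_p} V` for unramified `V`;
* `hodgeTateWeights_bdR_of_unramified` — `hodgeTateWeights ρ = {0, …, 0}`;
* `FramedRep.isDeRhamWith_bdR_of_isLocallyUnramified`,
  `FramedRep.isDeRhamWithWeightsIn_bdR_of_isLocallyUnramified` — the framed `ℚ̄_p`-valued forms;
* `PstWeilDeligneData.unramifiedWeightsZero_of_bdR` — **clause (F3) `UnramifiedWeightsZero` of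
  `IsFontaineDatum` (file `FontaineDpst`) holds for every `p`-adic Hodge datum whose period ring is
  `bdRPeriodRingData hp`**, as does its structure axiom `isDeRhamWith_of_isLocallyUnramified`
  (`FramedRep.isDeRhamWith_bdR_of_isLocallyUnramified`).

All statements hold for every `ℚ_p`-algebra structure on `F` (there is only one,
`LocalField.ringHom_padic_ext`; `algebraMap_padic_bdRPeriodRingData`) — in particular for the
canonical one of clause (F1).  Companion of `BdRCyclotomic` (clause (F2) for the same datum).
No definitions, no named facts.

## References
* [FontaineAsterisque223III] J.-M. Fontaine, Astérisque 223 (1994), Exp. III §1.5, §5.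
* [FontaineOuyang2022] J.-M. Fontaine, Y. Ouyang, *Theory of p-adic Galois representations*, Prop. 2.14, Thm. 2.13.
-/

noncomputable section

open WittVector IsLocalRing Field ValuativeRel
open scoped ValuativeRel

namespace Literature.NumberTheory.PAdicHodge

open Literature.NumberTheory.GaloisRepresentations
open Literature.NumberTheory.GaloisRepresentations.IsNonarchimedeanLocalField
open Literature.NumberTheory.Automorphic

variable {F : Type} [Field F] [ValuativeRel F] [TopologicalSpace F] [IsNonarchimedeanLocalField F]
  [CharZero F] {p : ℕ} [Fact p.Prime] [Fact (¬ IsUnit (p : integerC F))]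
  [IsAdicComplete (Ideal.span {(p : integerC F)}) (integerC F)] [Algebra ℚ_[p] F]
  (hp : valuation F p < 1)

/-! ### The `ℚ_p`-algebra map of `bdRPeriodRingData` -/

/-- **The `ℚ_p`-algebra map of `bdRPeriodRingData` is `qpToBdR`** — for EVERY `ℚ_p`-algebra
structure on `F` (they all coincide, `LocalField.ringHom_padic_ext`; the `F`-algebra map is
`F ↪ B_dR⁺ ⊆ B_dR`, `algebraMap_bdRPeriodRingData` of file `BdRCyclotomic`). [folklore] -/
theorem algebraMap_padic_bdRPeriodRingData (z : ℚ_[p]) :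
    algebraMap ℚ_[p] (bdRPeriodRingData (F := F) (p := p) hp).B z =
      algebraMap (BDeRhamPlus (integerC F) p) (FracBdR F p) (qpToBdR z) := by
  rw [PeriodRingData.algebraMap_eq, algebraMap_bdRPeriodRingData (surjective_fontaineTheta_integerC hp) hp]
  have h : algebraMap ℚ_[p] F z = algebraMap (PadicBase F p hp) F ((PadicBase.toPadic hp).symm z) :=
    RingHom.congr_fun (LocalField.ringHom_padic_ext (algebraMap ℚ_[p] F)
      ((algebraMap (PadicBase F p hp) F).comp (PadicBase.toPadic hp).symm.toRingHom)) z
  rw [h, embBdRHom_algebraMap, RingEquiv.apply_symm_apply]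

/-! ### Unramified ⇒ de Rham of weight `0` -/

-- Mathlib's own global value of `maxSynthPendingDepth` (as in `PeriodRingData.isAdmissible_of_unramified`).
set_option maxSynthPendingDepth 3 in
/-- **Unramified representations are de Rham**: for `B_dR(F)` (`bdRPeriodRingData`), every continuous
`ℚ_p`-linear representation of `Γ_F` on a finite-dimensional Hausdorff space with trivial inertia
action is admissible, `dim_F D_dR(V) = dim V` (the period ring receives `W(k̄)` equivariantly:
`isAdmissible_of_unramified_witt` with `ι = wittToFracBdR`). [cite: FontaineAsterisque223III, Exp. III §1.5 and §5]
[cite: FontaineOuyang2022, Prop. 2.14] -/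
theorem isAdmissible_bdR_of_unramified
    {V : Type} [AddCommGroup V] [Module ℚ_[p] V] [TopologicalSpace V] [IsTopologicalAddGroup V]
    [ContinuousSMul ℚ_[p] V] [T2Space V] [FiniteDimensional ℚ_[p] V]
    (ρ : ContinuousRep (absoluteGaloisGroup F) ℚ_[p] V)
    (hρ : ∀ σ ∈ absInertia F, ∀ v : V, ρ σ v = v) :
    (bdRPeriodRingData (F := F) (p := p) hp).IsAdmissible ρ := by
  haveI : Fact (¬ IsUnit (p : maxUnramifiedCompletion F)) := ⟨not_isUnit_natCast_completion hp⟩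
  haveI : CharP (IsLocalRing.ResidueField (maxUnramifiedCompletion F)) p := charP_residueField_completion
  exact PeriodRingData.isAdmissible_of_unramified_witt (bdRPeriodRingData hp) (wittToFracBdR F p)
    (fun σ x => smul_wittToFracBdR σ x)
    (fun z => (wittToFracBdR_eq (padicIntToWitt F p) z).trans (algebraMap_padic_bdRPeriodRingData hp (z : ℚ_[p])).symm) ρ hρ

-- Mathlib's own global value of `maxSynthPendingDepth`.
set_option maxSynthPendingDepth 3 in
/-- **Unramified representations have all Hodge–Tate weights `0` for `B_dR(F)`**:
`hodgeTateWeights ρ = {0, …, 0}` (`dim V` times) — `Fil⁰ D_dR = D_dR` (the periods lie in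
`W(k̄) ⊆ B_dR⁺`) and `Fil¹ D_dR = 0` (apply `θ`). [cite: FontaineAsterisque223III, Exp. III §5]
[cite: FontaineOuyang2022, Prop. 2.14] -/
theorem hodgeTateWeights_bdR_of_unramified
    {V : Type} [AddCommGroup V] [Module ℚ_[p] V] [TopologicalSpace V] [IsTopologicalAddGroup V]
    [ContinuousSMul ℚ_[p] V] [T2Space V] [FiniteDimensional ℚ_[p] V]
    (ρ : ContinuousRep (absoluteGaloisGroup F) ℚ_[p] V)
    (hρ : ∀ σ ∈ absInertia F, ∀ v : V, ρ σ v = v) :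
    (bdRPeriodRingData (F := F) (p := p) hp).hodgeTateWeights ρ = Multiset.replicate (Module.finrank ℚ_[p] V) 0 := by
  haveI : Fact (¬ IsUnit (p : maxUnramifiedCompletion F)) := ⟨not_isUnit_natCast_completion hp⟩
  haveI : CharP (IsLocalRing.ResidueField (maxUnramifiedCompletion F)) p := charP_residueField_completion
  haveI : IsAdicComplete (Ideal.span {(p : maxUnramifiedCompletion F)}) (maxUnramifiedCompletion F) :=
    isAdicComplete_span_natCast_completion hp (Nat.Prime.ne_zero Fact.out)
  have hF : Function.Surjective (fontaineTheta (integerC F) p) := surjective_fontaineTheta_integerC hp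
  haveI : IsDomain (BDeRhamPlus (integerC F) p) := isDomain_bDeRhamPlus hF
  exact PeriodRingData.hodgeTateWeights_of_unramified_witt (bdRPeriodRingData hp) (wittToFracBdR F p)
    (fun σ x => smul_wittToFracBdR σ x)
    (fun z => (wittToFracBdR_eq (padicIntToWitt F p) z).trans (algebraMap_padic_bdRPeriodRingData hp (z : ℚ_[p])).symm)
    (fun x => wittToFracBdR_mem_fil_zero hp hF x)
    (fun hX _ h => eq_zero_of_sum_smul_wittToFracBdR_mem_fil_one hp hF hX h) ρ hρ

/-- **Unramified `ρ : Γ_F →ₜ* GL_n(ℚ̄_p)` are de Rham** (for `B_dR(F)`): a finite model over `E/ℚ_p`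
(`exists_hasQlModel_holds`) is unramified and its underlying `ℚ_p`-linear representation is
`B_dR`-admissible.  This is the structure axiom `isDeRhamWith_of_isLocallyUnramified` of
`PstWeilDeligneData` for every datum on `bdRPeriodRingData`. [cite: FontaineAsterisque223III, Exp. III §5] -/
theorem _root_.Literature.NumberTheory.GaloisRepresentations.FramedRep.isDeRhamWith_bdR_of_isLocallyUnramified {n : ℕ}
    (ρ : FramedRep (absoluteGaloisGroup F) (PadicAlgCl p) n) (hρ : ρ.IsLocallyUnramified) :
    ρ.IsDeRhamWith ‹Algebra ℚ_[p] F› (bdRPeriodRingData (F := F) (p := p) hp) := by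
  obtain ⟨E, rE, hfin, hmodel⟩ := exists_hasQlModel_holds ρ
  haveI : FiniteDimensional ℚ_[p] E := hfin
  haveI : ContinuousSMul ℚ_[p] E := IntermediateField.continuousSMul_padicAlgCl E
  exact ⟨E, hfin, rE, hmodel, isAdmissible_bdR_of_unramified hp (restrictScalarsQl E rE)
    (fun σ hσ x => restrictScalarsQl_apply_eq_self_of_isLocallyUnramified hρ hmodel σ hσ x)⟩

/-- **Unramified `ρ : Γ_F →ₜ* GL_n(ℚ̄_p)` are de Rham with Hodge–Tate weights in `[0, 0]`** (for
`B_dR(F)`). [cite: FontaineAsterisque223III, Exp. III §5] -/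
theorem _root_.Literature.NumberTheory.GaloisRepresentations.FramedRep.isDeRhamWithWeightsIn_bdR_of_isLocallyUnramified {n : ℕ}
    (ρ : FramedRep (absoluteGaloisGroup F) (PadicAlgCl p) n) (hρ : ρ.IsLocallyUnramified) :
    ρ.IsDeRhamWithWeightsIn (bdRPeriodRingData (F := F) (p := p) hp) 0 0 := by
  obtain ⟨E, rE, hfin, hmodel⟩ := exists_hasQlModel_holds ρ
  haveI : FiniteDimensional ℚ_[p] E := hfin
  haveI : ContinuousSMul ℚ_[p] E := IntermediateField.continuousSMul_padicAlgCl E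
  have hunr : ∀ σ ∈ absInertia F, ∀ x : Fin n → E, restrictScalarsQl E rE σ x = x :=
    fun σ hσ x => restrictScalarsQl_apply_eq_self_of_isLocallyUnramified hρ hmodel σ hσ x
  refine ⟨E, hfin, rE, hmodel, isAdmissible_bdR_of_unramified hp (restrictScalarsQl E rE) hunr, fun w hw => ?_⟩
  rw [hodgeTateWeights_bdR_of_unramified hp (restrictScalarsQl E rE) hunr] at hw
  rw [Multiset.eq_of_mem_replicate hw]
  exact ⟨le_rfl, le_rfl⟩

omit [Algebra ℚ_[p] F] in
/-- **Clause (F3) `UnramifiedWeightsZero` and the axiom `isDeRhamWith_of_isLocallyUnramified` hold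
for every `p`-adic Hodge datum whose period ring is `B_dR(F)`** (`𝔇.𝔅 = bdRPeriodRingData hp` for
the datum's own `ℚ_p`-algebra structure). [cite: FontaineAsterisque223III, Exp. III §5] -/
theorem _root_.Literature.NumberTheory.GaloisRepresentations.PstWeilDeligneData.unramifiedWeightsZero_of_bdR (𝔇 : PstWeilDeligneData F p)
    (h𝔅 : 𝔇.𝔅 = (letI := 𝔇.algebra; bdRPeriodRingData (F := F) (p := p) hp)) :
    𝔇.UnramifiedWeightsZero := by
  intro n ρ hρ
  letI := 𝔇.algebra
  show ρ.IsDeRhamWithWeightsIn 𝔇.𝔅 0 0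
  rw [h𝔅]
  exact ρ.isDeRhamWithWeightsIn_bdR_of_isLocallyUnramified hp hρ

end Literature.NumberTheory.PAdicHodge

end
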